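import Summits.CriticalPhenomena.PercolationContinuityZ3.Theorems.PercNearOneGluingNoHeavyLowerTailCILSeriesReduction
import Summits.CriticalPhenomena.PercolationContinuityZ3.Theorems.PercNearOneGluingNoHeavyLowerTailCILIsolatedObserver
import HarnessLib

/-!
# `NoHeavyLowerTail` (stmt-CriticalPhenomena-4575) — CIL at every observer whose fellow non-relays have at most two
# positive-weight pairs (hulls made of Steiner paths and cycles: the series law)

Support file (prover `prim-hp-3`, hull-port line, electrical-network technique; `--supports stmt-CriticalPhenomena-4575`).
No definitions, no named facts, no sorries.

* `HullPort.cil_of_steinerDegreeLeTwo` — let `o ∉ A` (`A ≠ ∅`) and suppose every non-relay `v ≠ o` has all its positive-weight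
  pairs inside some two-element set (`∃ x y, ∀ u ≠ v, w s(v,u) ≠ 0 → u = x ∨ u = y`; the weighted graph is otherwise arbitrary:
  any number of relays, any weights, any pairs among relays and at `o`).  Then the cumulative isolation lemma holds at `o` at
  every level: `∃ a ∈ A, μ{1 ≤ N ≤ j} ≤ μ{|π(a)| ≤ j}` — the conclusion of the registered stub `stub_cumulativeIsolation` for
  this class.  It contains the observers whose Steiner hull is a union of paths and cycles through `o` and the ports (e.g.
  `Theorems.…CILSteinerPath`'s Steiner path with relay hairs, several internally disjoint or merging `o`–port Steiner paths,
  Steiner cycles through `o`), with ANY number of hull ports.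
  Proof: induction on the number of non-relays `≠ o` carrying a positive pair; such a vertex `z` of degree ≤ 2 is removed by
  the series law `HullPort.series_reduction` (its two pairs `z–x`, `z–y` become an extra pair `x–y` of weight `αβ` superposed
  on the old one), which preserves `bad(o)` and every `I(a)` and does not raise any other non-relay's degree; with no such
  vertex left the observer is joined only to relays and `Theorems.cumulativeIsolation_of_isolatedObserver` (Kozma–Nitzan /
  BHK) applies.
-/

noncomputable section

namespace Summit.CriticalPhenomena.PercolationContinuityZ3.Theorems

open MeasureTheory Set Literature.Probability.LatticeModels Literature.Probability.Percolation
open scoped Classical BigOperators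

variable {n : ℕ}

namespace HullPort

/-- The series-reduced weight function: pairs at `z` switched off (the idle diagonal pair kept), the pair `x–y` raised to
`1 − (1 − w(xy))(1 − w(zx)·w(zy))`. [folklore] -/
theorem seriesWeight_mem (w : Sym2 (Fin n) → unitInterval) (z x y : Fin n) :
    1 - (1 - (w s(x, y) : ℝ)) * (1 - (w s(z, x) : ℝ) * w s(z, y)) ∈ unitInterval := by
  have h1 := (w s(x, y)).2.1; have h2 := (w s(x, y)).2.2
  have h3 := (w s(z, x)).2.1; have h4 := (w s(z, x)).2.2
  have h5 := (w s(z, y)).2.1; have h6 := (w s(z, y)).2.2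
  have hab : (w s(z, x) : ℝ) * w s(z, y) ≤ 1 := by nlinarith
  have hab0 : 0 ≤ (w s(z, x) : ℝ) * w s(z, y) := mul_nonneg h3 h5
  constructor
  · nlinarith [mul_nonneg (sub_nonneg.2 h2) (sub_nonneg.2 hab)]
  · nlinarith [mul_nonneg (sub_nonneg.2 h2) (sub_nonneg.2 hab)]

/-- **CIL for observers whose fellow non-relays have degree at most two.**  See the module docstring.
[cite: VandenbergHaggstromKahn2005, Thm. 1.5 — via `cumulativeIsolation_of_isolatedObserver`; the series law is folklore] -/
theorem cil_of_steinerDegreeLeTwo (w : Sym2 (Fin n) → unitInterval) (A : Finset (Fin n)) (o : Fin n) (j : ℕ)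
    (hA : A.Nonempty) (hoA : o ∉ A)
    (hdeg : ∀ v, v ≠ o → v ∉ A → ∃ x y : Fin n, ∀ u, u ≠ v → w s(v, u) ≠ 0 → u = x ∨ u = y) :
    ∃ a ∈ A,
      (prodBernoulli w).real {ω : BondConfig (Fin n) |
          1 ≤ (A.filter fun r => ω ∈ openConn o r).card ∧ (A.filter fun r => ω ∈ openConn o r).card ≤ j} ≤
        (prodBernoulli w).real {ω : BondConfig (Fin n) | (A.filter fun r => ω ∈ openConn a r).card ≤ j} := by
  -- induction on the number of active non-relays other than `o`
  suffices H : ∀ (N : ℕ) (u : Sym2 (Fin n) → unitInterval),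
      (Finset.univ.filter fun v : Fin n => v ≠ o ∧ v ∉ A ∧ ∃ t, t ≠ v ∧ u s(v, t) ≠ 0).card ≤ N →
      (∀ v, v ≠ o → v ∉ A → ∃ x y : Fin n, ∀ t, t ≠ v → u s(v, t) ≠ 0 → t = x ∨ t = y) →
      ∃ a ∈ A,
        (prodBernoulli u).real {ω : BondConfig (Fin n) |
            1 ≤ (A.filter fun r => ω ∈ openConn o r).card ∧ (A.filter fun r => ω ∈ openConn o r).card ≤ j} ≤
          (prodBernoulli u).real {ω : BondConfig (Fin n) | (A.filter fun r => ω ∈ openConn a r).card ≤ j} from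
    H _ w le_rfl hdeg
  intro N
  induction N with
  | zero =>
    intro u hcard hdegu
    have hempty := Finset.card_eq_zero.mp (Nat.le_zero.mp hcard)
    -- every non-relay other than `o` is isolated, so `o` is joined only to relays
    have hiso : ∀ v, v ≠ o → v ∉ A → u s(o, v) = 0 := by
      intro v hvo hvA
      by_contra hne
      have : v ∈ Finset.univ.filter fun v : Fin n => v ≠ o ∧ v ∉ A ∧ ∃ t, t ≠ v ∧ u s(v, t) ≠ 0 :=
        Finset.mem_filter.mpr ⟨Finset.mem_univ _, hvo, hvA, o, hvo.symm, by rw [Sym2.eq_swap]; exact hne⟩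
      rw [hempty] at this
      exact absurd this (Finset.notMem_empty _)
    exact cumulativeIsolation_of_isolatedObserver u A o j hA hiso
  | succ N ih =>
    intro u hcard hdegu
    set Act := Finset.univ.filter fun v : Fin n => v ≠ o ∧ v ∉ A ∧ ∃ t, t ≠ v ∧ u s(v, t) ≠ 0 with hAct
    by_cases hsmall : Act.card ≤ N
    · exact ih u hsmall hdegu
    -- pick an active non-relay `z`
    have hne : Act.Nonempty := by
      rw [← Finset.card_pos]; omega
    obtain ⟨z, hz⟩ := hne
    obtain ⟨hzo, hzA, t₀, ht₀z, ht₀⟩ := (Finset.mem_filter.mp hz).2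
    obtain ⟨x₁, y₁, hcov⟩ := hdegu z hzo hzA
    obtain ⟨r, hr⟩ := hA
    have hrz : r ≠ z := fun h => hzA (h ▸ hr)
    have hro : r ≠ o := fun h => hoA (h ▸ hr)
    -- two DISTINCT vertices `x ≠ y`, both `≠ z`, covering the positive partners of `z`
    have hxy : ∃ x y : Fin n, x ≠ z ∧ y ≠ z ∧ x ≠ y ∧ ∀ t, t ≠ z → u s(z, t) ≠ 0 → t = x ∨ t = y := by
      -- normalise `x₁, y₁`: replace any of them equal to `z` (useless) by a fresh vertex among `o, r`
      have fresh : ∀ a : Fin n, ∃ b : Fin n, b ≠ z ∧ b ≠ a := by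
        intro a
        by_cases hao : a = o
        · exact ⟨r, hrz, by rw [hao]; exact hro⟩
        · exact ⟨o, Ne.symm hzo, Ne.symm hao⟩
      -- first coordinate
      have hx : ∃ x : Fin n, x ≠ z ∧ ∀ t, t ≠ z → u s(z, t) ≠ 0 → t = x ∨ t = y₁ := by
        by_cases hx₁ : x₁ = z
        · obtain ⟨b, hbz, -⟩ := fresh y₁
          refine ⟨b, hbz, fun t ht hut => ?_⟩
          rcases hcov t ht hut with h | h
          · exact absurd (h.trans hx₁) ht
          · exact Or.inr h
        · exact ⟨x₁, hx₁, hcov⟩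
      obtain ⟨x, hxz, hcovx⟩ := hx
      by_cases hy₁ : y₁ = z ∨ y₁ = x
      · -- `y₁` is useless or a duplicate: the partners are inside `{x}`; add a fresh second vertex
        obtain ⟨b, hbz, hbx⟩ := fresh x
        refine ⟨x, b, hxz, hbz, Ne.symm hbx, fun t ht hut => ?_⟩
        rcases hcovx t ht hut with h | h
        · exact Or.inl h
        · rcases hy₁ with h' | h'
          · exact absurd (h.trans h') ht
          · exact Or.inl (h.trans h')
      · push Not at hy₁
        exact ⟨x, y₁, hxz, hy₁.1, Ne.symm hy₁.2, hcovx⟩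
    obtain ⟨x, y, hxz, hyz, hxy, hcov2⟩ := hxy
    -- the series-reduced weights
    set σ : unitInterval := ⟨_, seriesWeight_mem u z x y⟩ with hσ
    set u' : Sym2 (Fin n) → unitInterval := fun e =>
      if e = s(x, y) then σ else if z ∈ e ∧ e ≠ s(z, z) then 0 else u e with hu'
    have hzxy : z ∉ s(x, y) := by
      rw [Sym2.mem_iff, not_or]; exact ⟨Ne.symm hxz, Ne.symm hyz⟩
    have hu'z : ∀ v, v ≠ z → u' s(z, v) = 0 := by
      intro v hv
      have h1 : s(z, v) ≠ s(x, y) := fun h => hzxy (h ▸ Sym2.mem_mk_left z v)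
      have h2 : s(z, v) ≠ s(z, z) := by
        intro h; rw [Sym2.eq_iff] at h
        rcases h with ⟨-, h⟩ | ⟨-, h⟩
        · exact hv h
        · exact hv h
      simp only [hu', h1, if_false, Sym2.mem_mk_left, h2, ne_eq, not_false_eq_true, and_self, if_true]
    have hu'zz : u' s(z, z) = u s(z, z) := by
      have h1 : s(z, z) ≠ s(x, y) := fun h => hzxy (h ▸ Sym2.mem_mk_left z z)
      simp only [hu', h1, if_false, ne_eq, not_true_eq_false, and_false]
    have hu'off : ∀ e : Sym2 (Fin n), z ∉ e → e ≠ s(x, y) → u' e = u e := by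
      intro e hze hexy
      simp only [hu', hexy, if_false, hze, false_and]
    have hu'xy : (u' s(x, y) : ℝ) = 1 - (1 - u s(x, y)) * (1 - u s(z, x) * u s(z, y)) := by
      simp only [hu', if_true, hσ]
    have hzcov : ∀ v, v ≠ z → v ≠ x → v ≠ y → u s(z, v) = 0 := by
      intro v hv hvx hvy
      by_contra h
      rcases hcov2 v hv h with h' | h'
      · exact hvx h'
      · exact hvy h'
    -- the series law: `bad(o)` and every `I(a)`, `a ∈ A`, are the same for `u` and `u'`
    have hbad := series_reduction u u' A z x y hzA (Ne.symm hxz) (Ne.symm hyz) hxy hzcov hu'z hu'zz hu'off hu'xy o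
      (Ne.symm hzo) (fun S => 1 ≤ S.card ∧ S.card ≤ j)
    have hI : ∀ a ∈ A, (prodBernoulli u).real {ω : BondConfig (Fin n) | (A.filter fun r => ω ∈ openConn a r).card ≤ j} =
        (prodBernoulli u').real {ω : BondConfig (Fin n) | (A.filter fun r => ω ∈ openConn a r).card ≤ j} :=
      fun a ha => series_reduction u u' A z x y hzA (Ne.symm hxz) (Ne.symm hyz) hxy hzcov hu'z hu'zz hu'off hu'xy a
        (fun h => hzA (h ▸ ha)) (fun S => S.card ≤ j)
    -- the reduced graph has fewer active non-relays …
    set Act' := Finset.univ.filter fun v : Fin n => v ≠ o ∧ v ∉ A ∧ ∃ t, t ≠ v ∧ u' s(v, t) ≠ 0 with hAct'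
    have hsub : Act' ⊆ Act.erase z := by
      intro v hv
      obtain ⟨hvo, hvA, t, htv, hut⟩ := (Finset.mem_filter.mp hv).2
      rw [Finset.mem_erase]
      have hvz : v ≠ z := by
        rintro rfl
        exact hut (hu'z t htv)
      refine ⟨hvz, Finset.mem_filter.mpr ⟨Finset.mem_univ _, hvo, hvA, ?_⟩⟩
      -- an active pair of `v` in `u'` comes from an active pair of `v` in `u`
      by_cases hexy : s(v, t) = s(x, y)
      · -- `v ∈ {x, y}` and the pair `x–y` has positive reduced weight
        have hσpos : (u' s(x, y) : ℝ) ≠ 0 := by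
          rw [← hexy]; exact fun h => hut (Subtype.ext h)
        rw [hu'xy] at hσpos
        -- either `u(xy) ≠ 0` or both `u(zx), u(zy) ≠ 0`
        have hvxy : v = x ∨ v = y := by
          have : v ∈ s(x, y) := hexy ▸ Sym2.mem_mk_left v t
          exact Sym2.mem_iff.mp this
        by_cases hγ : (u s(x, y) : ℝ) = 0
        · have hαβ : (u s(z, x) : ℝ) * u s(z, y) ≠ 0 := by
            intro h; apply hσpos; rw [hγ, h]; ring
          rcases hvxy with rfl | rfl
          · refine ⟨z, Ne.symm hvz, ?_⟩
            rw [Sym2.eq_swap]; exact fun h => hαβ (by rw [h]; simp)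
          · refine ⟨z, Ne.symm hvz, ?_⟩
            rw [Sym2.eq_swap]; exact fun h => hαβ (by rw [h]; simp)
        · refine ⟨t, htv, ?_⟩
          rw [hexy]; exact fun h => hγ (by rw [h]; rfl)
      · by_cases hzvt : z ∈ s(v, t)
        · -- then `t = z` and the pair was switched off: contradiction
          exfalso
          have htz : t = z := by
            rcases Sym2.mem_iff.mp hzvt with h | h
            · exact absurd h.symm hvz
            · exact h.symm
          apply hut
          rw [htz, Sym2.eq_swap]; exact hu'z v hvz
        · exact ⟨t, htv, by rwa [hu'off _ hzvt hexy] at hut⟩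
    have hcard' : Act'.card ≤ N := by
      have h1 := Finset.card_le_card hsub
      rw [Finset.card_erase_of_mem hz] at h1
      omega
    -- … and still has all non-relay degrees ≤ 2
    have hdeg' : ∀ v, v ≠ o → v ∉ A → ∃ x' y' : Fin n, ∀ t, t ≠ v → u' s(v, t) ≠ 0 → t = x' ∨ t = y' := by
      intro v hvo hvA
      by_cases hvz : v = z
      · refine ⟨x, y, fun t ht hut => ?_⟩
        exact absurd (hu'z t (hvz ▸ ht)) (hvz ▸ hut)
      obtain ⟨xv, yv, hcv⟩ := hdegu v hvo hvA
      -- partners of `v` in `u'`: old partners other than `z`, plus possibly the other end of `x–y`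
      have key : ∀ t, t ≠ v → u' s(v, t) ≠ 0 →
          (t ≠ z ∧ (t = xv ∨ t = yv)) ∨ (s(v, t) = s(x, y) ∧ ((u s(x, y) : ℝ) ≠ 0 ∨ (u s(z, x) : ℝ) * u s(z, y) ≠ 0)) := by
        intro t ht hut
        by_cases hexy : s(v, t) = s(x, y)
        · right
          refine ⟨hexy, ?_⟩
          have hσpos : (u' s(x, y) : ℝ) ≠ 0 := by
            rw [← hexy]; exact fun h => hut (Subtype.ext h)
          rw [hu'xy] at hσpos
          by_contra hh
          push Not at hh
          apply hσpos; rw [hh.1, hh.2]; ring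
        · left
          by_cases hzvt : z ∈ s(v, t)
          · exfalso
            have htz : t = z := by
              rcases Sym2.mem_iff.mp hzvt with h | h
              · exact absurd h.symm hvz
              · exact h.symm
            apply hut; rw [htz, Sym2.eq_swap]; exact hu'z v hvz
          · have htz : t ≠ z := fun h => hzvt (h ▸ Sym2.mem_mk_right v t)
            rw [hu'off _ hzvt hexy] at hut
            exact ⟨htz, hcv t ht hut⟩
      -- case analysis on whether `z` was a partner slot of `v`
      by_cases hvx : v = x ∨ v = y
      · -- `v` is an endpoint of the new pair; its other endpoint
        set t₁ : Fin n := if v = x then y else x with ht₁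
        have ht₁v : ∀ t, s(v, t) = s(x, y) → t = t₁ := by
          intro t h
          rw [Sym2.eq_iff] at h
          rcases h with ⟨h1, h2⟩ | ⟨h1, h2⟩
          · simp [ht₁, h1, h2]
          · have : ¬ v = x := by rw [h1]; exact Ne.symm hxy
            simp [ht₁, this, h2]
        by_cases hzslot : z = xv ∨ z = yv
        · -- `z` occupied a slot: the remaining old slot and `t₁`
          set s₁ : Fin n := if z = xv then yv else xv with hs₁
          refine ⟨s₁, t₁, fun t ht hut => ?_⟩
          rcases key t ht hut with ⟨htz, h⟩ | ⟨h, -⟩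
          · left
            rcases hzslot with hz' | hz'
            · rcases h with h | h
              · exact absurd (h.trans hz'.symm) htz
              · simp [hs₁, hz', h]
            · rcases h with h | h
              · have : ¬ z = xv := by rw [hz']; intro hh; exact htz (h.trans (hh ▸ hz'.symm ▸ rfl))
                simp [hs₁, this, h]
              · exact absurd (h.trans hz'.symm) htz
          · exact Or.inr (ht₁v t h)
        · -- `z` was not a partner of `v`: then `u(zv) = 0`, so a positive new pair means `u(xy) ≠ 0`, i.e. `t₁` was already a
          -- partner of `v`
          push Not at hzslot
          refine ⟨xv, yv, fun t ht hut => ?_⟩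
          rcases key t ht hut with ⟨-, h⟩ | ⟨h, hpos⟩
          · exact h
          · have huzv : u s(z, v) = 0 := by
              by_contra hh
              have := hcv z (Ne.symm hvz) (by rw [Sym2.eq_swap]; exact hh)
              rcases this with h' | h'
              · exact hzslot.1 h'
              · exact hzslot.2 h'
            have hαβ : (u s(z, x) : ℝ) * u s(z, y) = 0 := by
              rcases hvx with rfl | rfl
              · rw [huzv]; simp
              · rw [huzv]; simp
            rcases hpos with hγ | hαβ'
            · -- the old pair `x–y` was positive at `v`
              have := ht₁v t h
              have hold : u s(v, t₁) ≠ 0 := by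
                have e : s(v, t₁) = s(x, y) := by rw [← this]; exact h
                rw [e]; exact fun hh => hγ (by rw [hh]; rfl)
              have ht₁ne : t₁ ≠ v := by
                rcases hvx with rfl | rfl
                · simp [ht₁]; exact Ne.symm hxy
                · have : ¬ v = x := fun hh => hxy (hh.symm)
                  simp [ht₁, this]; exact hxy
              rw [this]
              exact hcv t₁ ht₁ne hold
            · exact absurd hαβ hαβ'
      · -- `v ∉ {x, y, z}`: partners unchanged except the switched-off pair to `z`
        push Not at hvx
        refine ⟨xv, yv, fun t ht hut => ?_⟩
        rcases key t ht hut with ⟨-, h⟩ | ⟨h, -⟩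
        · exact h
        · exfalso
          have : v ∈ s(x, y) := h ▸ Sym2.mem_mk_left v t
          rcases Sym2.mem_iff.mp this with h' | h'
          · exact hvx.1 h'
          · exact hvx.2 h'
    obtain ⟨a, ha, hle⟩ := ih u' hcard' hdeg'
    refine ⟨a, ha, ?_⟩
    rw [hbad, hI a ha]
    exact hle

end HullPort

end Summit.CriticalPhenomena.PercolationContinuityZ3.Theorems

end
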